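import Mathlib
import Summits.KontsevichZagierPeriods.Zeta5Search.DenomLaw.Profile19Path
import HarnessLib

/-!
# ζ(5) search — PATH ACCOUNTING FOR EVERY SORTED PARAMETER VECTOR ON THE THREE LONGEST FIRST-PERIOD PROFILES, IN ONE STATEMENT (`N_p ≥ 19`)

Cell `pub-zeta5` (HONEST FRAMING: systematic search; no irrationality claim unless certified), TRACK «DENOM-LAW» D1 prover seat
(denom-prover-d1 g17, `HOME/denom-law/prover-d1/ATTEMPT-17.md`).  Assembly of the three general-`b` profile theorems of this generation —
`FullProfile.pathAccountingFirstPeriod_fullProfile` (`N_p = 21`, `d < 4p`; THEOREM L5 / A⁗′ in the frame `(10,[1,−6,−6,1])`),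
`pathAccountingFirstPeriod_profile20` (`N_p = 20`; THEOREM LB / Lemma-D / ORIGIN law at `M = 8`) and `pathAccountingFirstPeriod_profile19` (`N_p = 19`;
double drop / ZERO law at `M = 8`) — into ONE statement about the node `DenomLaw.PathAccountingFirstPeriod` (Brown–Zudilin (28)+(30), Casoratian form):
**for EVERY sorted `b` of the polytope and every first-period prime `p ≥ 5` (`p² > b₀ + 2`) at which all seven parameters reach `p` (`p ≤ b₇`) and the
third-smallest pair block reaches `p` (`p ≤ b₀ − b₁ − b₄` and `p ≤ b₀ − b₂ − b₃`, i.e. at least 19 of the 21 pair blocks reach `p`), and `d(b) < 4p`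
(automatic unless all 21 blocks reach `p`: `pathAccounting_long19_short12`), the node's inequality holds** (`pathAccountingFirstPeriod_long19`; any-`j` form
`pathAccounting_long19`; the (CV) corollaries are in the three files).  No ray, no family: ten free integers.
The two smallest pair blocks of a sorted vector are always `b₀ − b₁ − b₂ ≤ b₀ − b₁ − b₃`, so the case split is on whether they reach `p`.
MODEL/structure-side valuation bookkeeping of the cell's own rationals; nothing about ζ(5); no γ; records in print UNMOVED.
-/

namespace Summit.KontsevichZagierPeriods.Zeta5Search.FullProfile

open Summit.KontsevichZagierPeriods.Zeta5Search.CasoratianValuation (InPolytope shift casoratian pairFloors refund)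
open Summit.KontsevichZagierPeriods.Zeta5Search.WedgeDictionary (dOf)
open Summit.KontsevichZagierPeriods.Zeta5Search.DenomLaw (cStar FirstPeriod Sorted7)
open Summit.KontsevichZagierPeriods.Zeta5Search.DenomLaw.FirstPeriodKit (sorted7_chain)

/-- **`PathAccountingFirstPeriod`'s conclusion for EVERY sorted `b` on the profiles `N_p ≥ 19`, every direction `j`**: all seven parameters and the
third-smallest pair block reach `p` (first period), and `d(b) < 4p`. -/
theorem pathAccounting_long19 (b : ℕ → ℤ) (j p : ℕ) (hb : InPolytope b) (hs : Sorted7 b) (hbj : InPolytope (shift b j))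
    (hj1 : 1 ≤ j) (hj7 : j ≤ 7) (hprime : p.Prime) (hp5 : 5 ≤ p) (hwin : (b 0 + 2 : ℤ) < (p : ℤ) ^ 2) (hfp : FirstPeriod b p)
    (hP : (p : ℤ) ≤ b 7) (hQ4 : (p : ℤ) + b 1 + b 4 ≤ b 0) (hQ23 : (p : ℤ) + b 2 + b 3 ≤ b 0) (hd4 : dOf b < 4 * (p : ℤ))
    (hcas : casoratian b j ≠ 0) :
    dOf b / (p : ℤ) - pairFloors b p - min (if 2 ≤ dOf b / (p : ℤ) then (1 : ℤ) else 0) (5 - (cStar b p : ℤ))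
      ≤ padicValRat p (casoratian b j) := by
  by_cases h12 : (p : ℤ) + b 1 + b 2 ≤ b 0
  · exact pathAccounting_fullProfile b j p hb hs hbj hj1 hj7 hprime hp5 hwin hfp hP h12 hd4 hcas
  by_cases h13 : (p : ℤ) + b 1 + b 3 ≤ b 0
  · exact pathAccounting_profile20 b j p hb hs hbj hj1 hj7 hprime hp5 hwin hfp hP (by linarith) h13 hcas
  · exact pathAccounting_profile19 b j p hb hs hbj hj1 hj7 hprime hp5 hwin hfp hP (by linarith) hQ4 hQ23 hcas

/-- **THE NODE FOR EVERY SORTED `b` ON THE PROFILES `N_p ≥ 19`: `PathAccountingFirstPeriod` with its binders VERBATIM plus `p ≤ b₇`, `p + b₁ + b₄ ≤ b₀`,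
`p + b₂ + b₃ ≤ b₀` (all parameters and at least nineteen pair blocks reach `p`) and `d(b) < 4p`.** -/
theorem pathAccountingFirstPeriod_long19 :
    ∀ (b : ℕ → ℤ) (p : ℕ), InPolytope b → Sorted7 b → InPolytope (shift b 7) →
      p.Prime → 5 ≤ p → (b 0 + 2 : ℤ) < (p : ℤ) ^ 2 → FirstPeriod b p →
      (p : ℤ) ≤ b 7 → (p : ℤ) + b 1 + b 4 ≤ b 0 → (p : ℤ) + b 2 + b 3 ≤ b 0 → dOf b < 4 * (p : ℤ) → casoratian b 7 ≠ 0 →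
        dOf b / (p : ℤ) - pairFloors b p - min (if 2 ≤ dOf b / (p : ℤ) then (1 : ℤ) else 0) (5 - (cStar b p : ℤ))
          ≤ padicValRat p (casoratian b 7) :=
  fun b p hb hs hb7 hprime hp5 hwin hfp hP hQ4 hQ23 hd4 hcas =>
    pathAccounting_long19 b 7 p hb hs hb7 (by norm_num) (by norm_num) hprime hp5 hwin hfp hP hQ4 hQ23 hd4 hcas

/-- **The same without the `d` hypothesis OFF the full profile**: if the smallest pair block is short (`b₀ < p + b₁ + b₂`), `d < 4p` is automatic. -/
theorem pathAccounting_long19_short12 (b : ℕ → ℤ) (j p : ℕ) (hb : InPolytope b) (hs : Sorted7 b) (hbj : InPolytope (shift b j))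
    (hj1 : 1 ≤ j) (hj7 : j ≤ 7) (hprime : p.Prime) (hp5 : 5 ≤ p) (hwin : (b 0 + 2 : ℤ) < (p : ℤ) ^ 2) (hfp : FirstPeriod b p)
    (hP : (p : ℤ) ≤ b 7) (hQ : b 0 < (p : ℤ) + b 1 + b 2) (hQ4 : (p : ℤ) + b 1 + b 4 ≤ b 0) (hQ23 : (p : ℤ) + b 2 + b 3 ≤ b 0)
    (hcas : casoratian b j ≠ 0) :
    dOf b / (p : ℤ) - pairFloors b p - min (if 2 ≤ dOf b / (p : ℤ) then (1 : ℤ) else 0) (5 - (cStar b p : ℤ))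
      ≤ padicValRat p (casoratian b j) := by
  by_cases h13 : (p : ℤ) + b 1 + b 3 ≤ b 0
  · exact pathAccounting_profile20 b j p hb hs hbj hj1 hj7 hprime hp5 hwin hfp hP hQ h13 hcas
  · exact pathAccounting_profile19 b j p hb hs hbj hj1 hj7 hprime hp5 hwin hfp hP (by linarith) hQ4 hQ23 hcas

end Summit.KontsevichZagierPeriods.Zeta5Search.FullProfile
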